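import Mathlib
import Summits.FinalStateConjecture.FinalStateConjecture.Theorems.PhotonSphereChannelsUniformPhotonSphereChannelsRPeelPrimitive
import Summits.FinalStateConjecture.FinalStateConjecture.Theorems.PhotonSphereChannelsUniformPhotonSphereChannelsRPeelDeficit
import Summits.FinalStateConjecture.FinalStateConjecture.Theorems.PhotonSphereChannelsUniformPhotonSphereChannelsRPeelPolynomial

/-!
# Peeling, file 16: towers down — transporting the `t = 0` deficit to level `0`

Support file for `stub_peel` of the line `crum-peeling-recessive-tower` (crux
`UniformPhotonSphereChannelsR`, stmt-FinalStateConjecture-14074).  Given the chain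
`θ_0 = ψ, …, θ_ℓ = φ` of file 15 (level states + the `t = 0` rung relations) and the static mode
`u` of `Q = U_ℓ`, `exists_descent` constructs smooth tower data `(α_k, β_k)` on `(a, ∞)`,
killed by `L_{U_k}^{ℓ−k+1}`, starting from `(c₀ u, 0)` at level `ℓ` (`c₀ = φ(0, xf)/u(xf)`) and
descending by `β_k = α_{k+1}' + W_k α_{k+1}`, `α_k = w_k (θ_k(0, xf)/w_k(xf) + ∫_{xf} β_{k+1}/w_k)`
(file 10), such that the static energies of the differences `θ_k(0,·) − α_k`,
`∂ₜθ_k(0,·) − β_k` on `(xf, ∞)` are all equal (file 12).  At level `0` the data generate a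
`t`-polynomial `C²` solution `p` of the `U_0`-equation on the half-plane (file 11) with
`∫_{(xf,∞)} e_{U_0}[ψ − p](0) = ∫_{(xf,∞)} (φ_t² + (φ_x − c₀u')² + Q(φ − c₀u)²)(0)`.
-/

noncomputable section

-- the doubled `FinalStateConjecture` component is the tree's fixed summit/problem path
set_option linter.dupNamespace false

namespace Summit.FinalStateConjecture.FinalStateConjecture.Theorems.CrumPeelingRecessiveTower

open MeasureTheory Set Filter Topology intervalIntegral
open scoped ContDiff

/-- Slice facts at `t = 0` for a `C²` function on the half-plane. -/
theorem slice_facts {θ : ℝ → ℝ → ℝ} {a : ℝ}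
    (hθ : ContDiffOn ℝ 2 (Function.uncurry θ) {z : ℝ × ℝ | a < z.2}) :
    (∀ x, a < x → HasDerivAt (θ 0) (deriv (θ 0) x) x) ∧
    ContinuousOn (fun x => deriv (θ 0) x) (Ioi a) ∧
    ContinuousOn (fun x => deriv (fun τ => θ τ x) 0) (Ioi a) ∧
    (∀ x, a < x → HasDerivAt (fun τ => θ τ x) (deriv (fun τ => θ τ x) 0) 0) ∧
    ContinuousOn (θ 0) (Ioi a) := by
  obtain ⟨dt, dx, -, -, -, hct, hcx, -, -, -, -, -, h1, h2, -, -, -, -, -, -⟩ := halfPlane_partials hθ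
  refine ⟨fun x hx => ?_, (continuousOn_slice_snd hcx 0).congr fun x hx => (h2 0 x hx).deriv,
    (continuousOn_slice_snd hct 0).congr fun x hx => (h1 0 x hx).deriv, fun x hx => ?_,
    continuousOn_slice_snd hθ.continuousOn 0⟩
  · rw [(h2 0 x hx).deriv]; exact h2 0 x hx
  · rw [(h1 0 x hx).deriv]; exact h1 0 x hx

/-- **Towers down.**  See the module docstring. -/
theorem exists_descent {a xf X₁ B C : ℝ} {ℓ : ℕ} {W U : ℕ → ℝ → ℝ} {θ : ℕ → ℝ → ℝ → ℝ} {u : ℝ → ℝ}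
    (haxf : a < xf) (haX : a < X₁) (hX1 : 1 ≤ X₁)
    (hUC : ∀ k, k ≤ ℓ → ContDiffOn ℝ ∞ (U k) (Ioi a))
    (hWC : ∀ k, k < ℓ → ContDiffOn ℝ ∞ (W k) (Ioi a))
    (hWd : ∀ k, k < ℓ → ∀ x, a < x → HasDerivAt (W k) (U k x - W k x ^ 2) x)
    (hUs : ∀ k, k < ℓ → ∀ x, a < x → U (k + 1) x = 2 * W k x ^ 2 - U k x)
    (hrec : ∀ k, k < ℓ → ∀ x, X₁ ≤ x → x * W k x ≤ -3 / 4 ∧ |x * W k x| ≤ B)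
    (hUB : ∀ k, k ≤ ℓ → ∀ x, X₁ ≤ x → |x ^ 2 * U k x| ≤ C)
    (hQ0 : ∀ x, a < x → 0 ≤ U ℓ x)
    (hlev : ∀ k, k ≤ ℓ →
      ContDiffOn ℝ 2 (Function.uncurry (θ k)) {z : ℝ × ℝ | a < z.2} ∧
      (∀ X, a < X → IntegrableOn (fun x => deriv (fun τ => θ k τ x) 0 ^ 2) (Ioi X)) ∧
      (∀ X, a < X → IntegrableOn (fun x => deriv (θ k 0) x ^ 2) (Ioi X)) ∧
      (∀ X, a < X → 1 ≤ X → IntegrableOn (fun x => (θ k 0 x / x) ^ 2) (Ioi X)) ∧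
      IntegrableOn (fun x => U k x * θ k 0 x ^ 2) (Ioi xf))
    (hrel : ∀ k, k < ℓ →
      (∀ x, a < x → deriv (fun τ => θ (k + 1) τ x) 0 = deriv (θ k 0) x - W k x * θ k 0 x) ∧
      (∀ x, a < x → deriv (θ (k + 1) 0) x = deriv (fun τ => θ k τ x) 0 - W k x * θ (k + 1) 0 x))
    (huC : ContDiffOn ℝ ∞ u (Ioi a)) (hu2 : ∀ x, a < x → iteratedDeriv 2 u x = U ℓ x * u x)
    (hupos : ∀ x, a < x → 0 < u x) (hule : ∀ x, xf ≤ x → u x ≤ u xf)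
    (huI1 : IntegrableOn (fun x => deriv u x ^ 2) (Ioi xf))
    (huI2 : IntegrableOn (fun x => U ℓ x * u x ^ 2) (Ioi xf)) :
    ∃ p : ℝ → ℝ → ℝ,
      ContDiffOn ℝ 2 (Function.uncurry p) {z : ℝ × ℝ | a < z.2} ∧
      (∀ t x, a < x →
        iteratedDeriv 2 (fun τ => p τ x) t - iteratedDeriv 2 (p t) x + U 0 x * p t x = 0) ∧
      (∃ (N : ℕ) (c : ℕ → ℝ → ℝ), ∀ t x, p t x = ∑ i ∈ Finset.range N, c i x * t ^ i) ∧
      IntegrableOn (fun x => deriv (fun τ => θ 0 τ x - p τ x) 0 ^ 2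
        + deriv (fun y => θ 0 0 y - p 0 y) x ^ 2 + U 0 x * (θ 0 0 x - p 0 x) ^ 2) (Ioi xf) ∧
      IntegrableOn (fun x => deriv (fun τ => θ ℓ τ x) 0 ^ 2
        + (deriv (θ ℓ 0) x - (θ ℓ 0 xf / u xf) * deriv u x) ^ 2
        + U ℓ x * (θ ℓ 0 x - (θ ℓ 0 xf / u xf) * u x) ^ 2) (Ioi xf) ∧
      ∫ x in Ioi xf, (deriv (fun τ => θ 0 τ x - p τ x) 0 ^ 2
        + deriv (fun y => θ 0 0 y - p 0 y) x ^ 2 + U 0 x * (θ 0 0 x - p 0 x) ^ 2)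
      = ∫ x in Ioi xf, (deriv (fun τ => θ ℓ τ x) 0 ^ 2
        + (deriv (θ ℓ 0) x - (θ ℓ 0 xf / u xf) * deriv u x) ^ 2
        + U ℓ x * (θ ℓ 0 x - (θ ℓ 0 xf / u xf) * u x) ^ 2) := by
  have hS : IsOpen (Ioi a) := isOpen_Ioi
  have hX₁0 : 0 < X₁ := by linarith
  set c₀ : ℝ := θ ℓ 0 xf / u xf with hc₀
  set L : ℕ → (ℝ → ℝ) → ℝ → ℝ := fun k f x => iteratedDeriv 2 f x - U k x * f x with hL
  -- the target energy at level `ℓ`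
  set Eℓ : ℝ := ∫ x in Ioi xf, (deriv (fun τ => θ ℓ τ x) 0 ^ 2
      + (deriv (θ ℓ 0) x - c₀ * deriv u x) ^ 2 + U ℓ x * (θ ℓ 0 x - c₀ * u x) ^ 2) with hEℓ
  -- common facts
  have hu0 : u xf ≠ 0 := (hupos xf haxf).ne'
  have huc : ContinuousOn u (Ioi a) := huC.continuousOn
  have hduC : ContDiffOn ℝ ∞ (deriv u) (Ioi a) := huC.deriv_of_isOpen hS le_rfl
  have hm : a < max xf 1 := lt_of_lt_of_le haxf (le_max_left _ _)
  have hm0 : 0 < max xf 1 := lt_of_lt_of_le one_pos (le_max_right _ _)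
  have hdiff : ∀ {g : ℝ → ℝ}, ContDiffOn ℝ ∞ g (Ioi a) → ∀ x, a < x → HasDerivAt g (deriv g x) x :=
    fun {g} hg x hx => ((hg.differentiableOn (by simp) x hx).differentiableAt (hS.mem_nhds hx)).hasDerivAt
  -- the base data `(c₀ u, 0)` at level `ℓ`
  obtain ⟨hCk, hI1, hI2, hI3, hQθ⟩ := hlev ℓ le_rfl
  obtain ⟨-, hdxc, hdtc, -, hθc⟩ := slice_facts hCk
  have hderiv : ∀ x, deriv (fun x => c₀ * u x) x = c₀ * deriv u x := fun x => deriv_const_mul_field c₀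
  -- the base data `(c₀ u, 0)`
  have hb5 : IntegrableOn (fun x => (deriv (fun τ => θ ℓ τ x) 0 - (0 : ℝ)) ^ 2) (Ioi xf) := by
    simpa using hI1 xf haxf
  have hb6 : IntegrableOn (fun x => (deriv (θ ℓ 0) x - deriv (fun x => c₀ * u x) x) ^ 2) (Ioi xf) := by
    refine integrableOn_sq_of_le haxf.le (hdxc.sub ((contDiffOn_const.mul hduC).continuousOn.congr
      fun x _ => hderiv x)) (((hI2 xf haxf).const_mul 2).add ((huI1.const_mul (c₀ ^ 2)).const_mul 2))
      fun x hx => ?_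
    simp only [Pi.add_apply]
    rw [hderiv x]
    nlinarith [sq_nonneg (deriv (θ ℓ 0) x + c₀ * deriv u x)]
  have hb7 : IntegrableOn (fun x => ((θ ℓ 0 x - c₀ * u x) / x) ^ 2) (Ioi (max xf 1)) := by
    have hux : IntegrableOn (fun x => (u x / x) ^ 2) (Ioi (max xf 1)) := by
      refine ((integrableOn_one_div_sq hm0).const_mul (u xf ^ 2)).mono'
        ((((huc.mono (Ioi_subset_Ioi hm.le)).div continuousOn_id fun x hx => (hm0.trans hx).ne').pow 2)
          |>.aestronglyMeasurable measurableSet_Ioi) ?_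
      filter_upwards [ae_restrict_mem measurableSet_Ioi] with x hx
      have hx0 : 0 < x := hm0.trans hx
      have hxf : xf ≤ x := le_trans (le_max_left _ _) hx.le
      have h1 : 0 < u x := hupos x (hm.trans hx)
      rw [Real.norm_eq_abs, abs_of_nonneg (sq_nonneg _), div_pow]
      have : u x ^ 2 ≤ u xf ^ 2 := pow_le_pow_left₀ h1.le (hule x hxf) 2
      calc u x ^ 2 / x ^ 2 ≤ u xf ^ 2 / x ^ 2 := div_le_div_of_nonneg_right this (by positivity)
        _ = u xf ^ 2 * (1 / x ^ 2) := by ring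
    have hcont : ContinuousOn (fun x => (θ ℓ 0 x - c₀ * u x) / x) (Ioi (max xf 1)) :=
      ((hθc.sub (continuousOn_const.mul huc)).mono (Ioi_subset_Ioi hm.le)).div continuousOn_id
        fun x hx => (hm0.trans hx).ne'
    refine integrableOn_sq_of_le le_rfl hcont (((hI3 _ hm (le_max_right _ _)).const_mul 2).add
      ((hux.const_mul (c₀ ^ 2)).const_mul 2)) fun x hx => ?_
    simp only [Pi.add_apply]
    have e : (θ ℓ 0 x - c₀ * u x) / x = θ ℓ 0 x / x - c₀ * (u x / x) := by ring
    rw [e]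
    nlinarith [sq_nonneg (θ ℓ 0 x / x + c₀ * (u x / x))]
  have hb8 : IntegrableOn (fun x => U ℓ x * (θ ℓ 0 x - c₀ * u x) ^ 2) (Ioi xf) := by
    refine ((hQθ.const_mul 2).add ((huI2.const_mul (c₀ ^ 2)).const_mul 2)).mono'
      ((((hUC ℓ le_rfl).continuousOn.mul ((hθc.sub (continuousOn_const.mul huc)).pow 2)).mono
        (Ioi_subset_Ioi haxf.le)).aestronglyMeasurable measurableSet_Ioi) ?_
    filter_upwards [ae_restrict_mem measurableSet_Ioi] with x hx
    have hQ := hQ0 x (haxf.trans hx)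
    rw [Real.norm_eq_abs, abs_of_nonneg (mul_nonneg hQ (sq_nonneg _))]
    simp only [Pi.add_apply]
    have h1 : (θ ℓ 0 x - c₀ * u x) ^ 2 ≤ 2 * θ ℓ 0 x ^ 2 + 2 * (c₀ ^ 2 * u x ^ 2) := by
      nlinarith [sq_nonneg (θ ℓ 0 x + c₀ * u x)]
    have := mul_le_mul_of_nonneg_left h1 hQ
    nlinarith
  have hb9 : IntegrableOn (fun x => (deriv (fun τ => θ ℓ τ x) 0 - (0 : ℝ)) ^ 2
      + (deriv (θ ℓ 0) x - deriv (fun x => c₀ * u x) x) ^ 2 + U ℓ x * (θ ℓ 0 x - c₀ * u x) ^ 2)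
      (Ioi xf) := (hb5.add hb6).add hb8
  -- descending induction on `j`, level `k` with `k + j = ℓ`
  have key : ∀ j, j ≤ ℓ → ∀ k, k + j = ℓ → ∃ α β : ℝ → ℝ,
      ContDiffOn ℝ ∞ α (Ioi a) ∧ ContDiffOn ℝ ∞ β (Ioi a) ∧
      EqOn ((L k)^[j + 1] α) (fun _ => 0) (Ioi a) ∧ EqOn ((L k)^[j + 1] β) (fun _ => 0) (Ioi a) ∧
      θ k 0 xf - α xf = 0 ∧
      IntegrableOn (fun x => (deriv (fun τ => θ k τ x) 0 - β x) ^ 2) (Ioi xf) ∧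
      IntegrableOn (fun x => (deriv (θ k 0) x - deriv α x) ^ 2) (Ioi xf) ∧
      IntegrableOn (fun x => ((θ k 0 x - α x) / x) ^ 2) (Ioi (max xf 1)) ∧
      IntegrableOn (fun x => (deriv (fun τ => θ k τ x) 0 - β x) ^ 2
        + (deriv (θ k 0) x - deriv α x) ^ 2 + U k x * (θ k 0 x - α x) ^ 2) (Ioi xf) ∧
      ∫ x in Ioi xf, ((deriv (fun τ => θ k τ x) 0 - β x) ^ 2
        + (deriv (θ k 0) x - deriv α x) ^ 2 + U k x * (θ k 0 x - α x) ^ 2) = Eℓ := by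
    intro j
    induction j with
    | zero =>
      intro _ k hk
      obtain rfl : ℓ = k := by omega
      refine ⟨fun x => c₀ * u x, fun _ => 0, contDiffOn_const.mul huC, contDiffOn_const, ?_, ?_, ?_,
        hb5, hb6, hb7, hb9, ?_⟩
      · intro x hx
        simp only [zero_add, Function.iterate_one, hL]
        rw [iteratedDeriv_const_mul_field, hu2 x hx]; ring
      · intro x _
        simp only [zero_add, Function.iterate_one, hL]
        simp
      · simp only [hc₀]; field_simp; ring
      · simp only [hEℓ]
        refine setIntegral_congr_fun measurableSet_Ioi fun x _ => ?_
        rw [hderiv x, sub_zero]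
    | succ j ih =>
      intro hj k hk
      have hk' : k < ℓ := by omega
      obtain ⟨αu, βu, hαuC, hβuC, hkαu, hkβu, hedge, hJ1, hJ2, hJ3, hEu, hEuq⟩ :=
        ih (by omega) (k + 1) (by omega)
      obtain ⟨hCk, hI1, hI2, hI3, -⟩ := hlev k hk'.le
      obtain ⟨hCk1, -, -, -, -⟩ := hlev (k + 1) (by omega)
      obtain ⟨hθkd, hdxkc, hdtkc, -, hθkc⟩ := slice_facts hCk
      obtain ⟨hθk1d, hdxk1c, hdtk1c, -, hθk1c⟩ := slice_facts hCk1
      -- the seed and the primitive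
      obtain ⟨w, hw0, hwd, hwC⟩ := exists_seed (hWC k hk')
      have hwc : ContinuousOn w (Ioi a) := hwC.continuousOn
      have hqC : ContDiffOn ℝ ∞ (fun y => βu y / w y) (Ioi a) := hβuC.div hwC fun y hy => (hw0 y hy).ne'
      have hqc : ContinuousOn (fun y => βu y / w y) (Ioi a) := hqC.continuousOn
      set Pβ : ℝ → ℝ := fun x => ∫ y in xf..x, βu y / w y with hPβ
      have hPβd : ∀ x, a < x → HasDerivAt Pβ (βu x / w x) x := by
        intro x hx
        have hint : IntervalIntegrable (fun s => βu s / w s) volume xf x := by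
          refine (hqc.mono fun s hs => ?_).intervalIntegrable
          rcases le_total xf x with h | h
          · rw [uIcc_of_le h] at hs; exact haxf.trans_le hs.1
          · rw [uIcc_of_ge h] at hs; exact hx.trans_le hs.1
        exact intervalIntegral.integral_hasDerivAt_right hint
          (hqc.stronglyMeasurableAtFilter isOpen_Ioi x hx) (hqc.continuousAt (Ioi_mem_nhds hx))
      have hPβC : ContDiffOn ℝ ∞ Pβ (Ioi a) :=
        contDiffOn_infty_of_deriv_eq (F := fun x _ => βu x / w x) hS
          (fun x hx => (hPβd x hx).differentiableAt.differentiableWithinAt)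
          (hqC.comp contDiffOn_fst fun p hp => (mem_prod.1 hp).1) fun x hx => (hPβd x hx).deriv
      set cst : ℝ := θ k 0 xf / w xf with hcst
      set α : ℝ → ℝ := fun x => w x * (cst + Pβ x) with hα
      set β : ℝ → ℝ := fun x => deriv αu x + W k x * αu x with hβ
      have hαC : ContDiffOn ℝ ∞ α (Ioi a) := hwC.mul (contDiffOn_const.add hPβC)
      have hβC : ContDiffOn ℝ ∞ β (Ioi a) := (contDiffOn_deriv_infty hS hαuC).add ((hWC k hk').mul hαuC)
      have hαd : ∀ x, a < x → HasDerivAt α (W k x * w x * (cst + Pβ x) + w x * (βu x / w x)) x := by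
        intro x hx
        have h : HasDerivAt (fun y => w y * (cst + Pβ y)) (W k x * w x * (cst + Pβ x) + w x * (βu x / w x)) x :=
          (hwd x hx).mul ((hPβd x hx).const_add cst)
        exact h
      have hαrel : EqOn (fun x => deriv α x - W k x * α x) βu (Ioi a) := by
        intro x hx
        have hwx := (hw0 x hx).ne'
        show deriv α x - W k x * α x = βu x
        rw [(hαd x hx).deriv]
        simp only [hα]
        field_simp
        ring
      obtain ⟨hkα, hkβ⟩ := towerData_descend hS (hWC k hk') (hUC (k + 1) (by omega))
        (fun x hx => hWd k hk' x hx) (fun x hx => hUs k hk' x hx) (m := j + 1) hαuC hβuC hαC hkαu hkβu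
        (fun x _ => rfl) hαrel
      have hedge' : θ k 0 xf - α xf = 0 := by
        have hwf := (hw0 xf haxf).ne'
        simp only [hα, hcst, hPβ, intervalIntegral.integral_same, add_zero]
        field_simp
        ring
      -- the deficit rung
      have hgu_eq : ∀ x, a < x → deriv (fun τ => θ k τ x) 0 - β x
          = (deriv (θ (k + 1) 0) x - deriv αu x) + W k x * (θ (k + 1) 0 x - αu x) := by
        intro x hx
        have h := (hrel k hk').2 x hx
        simp only [hβ]
        linarith
      obtain ⟨hg2, hdf2, hf3, he, -, heq⟩ := deficit_rung (Ut := U (k + 1))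
        (fu := fun x => θ (k + 1) 0 x - αu x) (dfu := fun x => deriv (θ (k + 1) 0) x - deriv αu x)
        (gu := fun x => deriv (fun τ => θ (k + 1) τ x) 0 - βu x)
        (f := fun x => θ k 0 x - α x) (df := fun x => deriv (θ k 0) x - deriv α x)
        haxf haX hX1 (hUC k hk'.le).continuousOn (hUC (k + 1) (by omega)).continuousOn
        (hWC k hk').continuousOn (hWd k hk') (hUs k hk') (fun x hx => (hrec k hk' x hx).1)
        (fun x hx => (hrec k hk' x hx).2) (hUB k hk'.le) hw0 hwd
        (fun x hx => (hθk1d x hx).sub (hdiff hαuC x hx))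
        (hdxk1c.sub (contDiffOn_deriv_infty hS hαuC).continuousOn)
        (hdtk1c.sub hβuC.continuousOn) hedge hJ1 hJ2 hJ3
        (fun x hx => (hθkd x hx).sub (hdiff hαC x hx))
        (fun x hx => by
          have h1 := (hrel k hk').1 x hx
          have h2 := hαrel hx
          simp only at h2
          linarith)
        hedge'
      refine ⟨α, β, hαC, hβC, hkα, hkβ, hedge', ?_, hdf2, hf3, ?_, ?_⟩
      · exact hg2.congr_fun (fun x hx => by rw [hgu_eq x (haxf.trans hx)]) measurableSet_Ioi
      · exact he.congr_fun (fun x hx => by rw [hgu_eq x (haxf.trans hx)]) measurableSet_Ioi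
      · rw [← hEuq, ← heq]
        exact setIntegral_congr_fun measurableSet_Ioi fun x hx => by rw [hgu_eq x (haxf.trans hx)]
  -- level `0`: the `t`-polynomial solution
  obtain ⟨α₀, β₀, hα₀C, hβ₀C, hkα₀, hkβ₀, -, -, -, -, hE0, hE0q⟩ := key ℓ le_rfl 0 (by simp)
  obtain ⟨p, hpC, hpsol, hpoly, hp0, hp1⟩ :=
    exists_towerSolution hS (hUC 0 (Nat.zero_le _)) (m := ℓ + 1) hα₀C hβ₀C hkα₀ hkβ₀
  obtain ⟨hθ0d, -, -, hθ0t, -⟩ := slice_facts (hlev 0 (Nat.zero_le _)).1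
  obtain ⟨hpd, -, -, hpt, -⟩ := slice_facts hpC
  have hident : ∀ x, a < x →
      deriv (fun τ => θ 0 τ x - p τ x) 0 ^ 2 + deriv (fun y => θ 0 0 y - p 0 y) x ^ 2
        + U 0 x * (θ 0 0 x - p 0 x) ^ 2
      = (deriv (fun τ => θ 0 τ x) 0 - β₀ x) ^ 2 + (deriv (θ 0 0) x - deriv α₀ x) ^ 2
        + U 0 x * (θ 0 0 x - α₀ x) ^ 2 := by
    intro x hx
    have e1 : deriv (fun τ => θ 0 τ x - p τ x) 0 = deriv (fun τ => θ 0 τ x) 0 - β₀ x := by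
      have hd : HasDerivAt (fun τ => θ 0 τ x - p τ x)
          (deriv (fun τ => θ 0 τ x) 0 - deriv (fun τ => p τ x) 0) 0 := (hθ0t x hx).sub (hpt x hx)
      rw [hd.deriv, hp1 x hx]
    have e2 : deriv (fun y => θ 0 0 y - p 0 y) x = deriv (θ 0 0) x - deriv α₀ x := by
      have hd : HasDerivAt (fun y => θ 0 0 y - p 0 y) (deriv (θ 0 0) x - deriv (p 0) x) x :=
        (hθ0d x hx).sub (hpd x hx)
      rw [hd.deriv, eqOn_deriv hS hp0 hx]
    rw [e1, e2, hp0 x hx]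
  refine ⟨p, hpC, hpsol, hpoly, ?_, ?_, ?_⟩
  · exact hE0.congr_fun (fun x hx => (hident x (haxf.trans hx)).symm) measurableSet_Ioi
  · refine hb9.congr_fun (fun x _ => ?_) measurableSet_Ioi
    show (deriv (fun τ => θ ℓ τ x) 0 - 0) ^ 2 + (deriv (θ ℓ 0) x - deriv (fun x => c₀ * u x) x) ^ 2
        + U ℓ x * (θ ℓ 0 x - c₀ * u x) ^ 2 = _
    rw [hderiv x, sub_zero]
  · rw [setIntegral_congr_fun measurableSet_Ioi fun x hx => hident x (haxf.trans hx), hE0q]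

/-- Registered sub-goal `peel_sliceFacts` of `stub_peel` (verbatim signature): `t = 0` slice facts of a `C²` function on the half-plane. -/
theorem peel_sliceFacts : ∀ (θ : ℝ → ℝ → ℝ) (a : ℝ), ContDiffOn ℝ 2 (Function.uncurry θ) {z : ℝ × ℝ | a < z.2} → (∀ x, a < x → HasDerivAt (θ 0) (deriv (θ 0) x) x) ∧ ContinuousOn (fun x => deriv (θ 0) x) (Set.Ioi a) ∧ ContinuousOn (fun x => deriv (fun τ => θ τ x) 0) (Set.Ioi a) ∧ (∀ x, a < x → HasDerivAt (fun τ => θ τ x) (deriv (fun τ => θ τ x) 0) 0) ∧ ContinuousOn (θ 0) (Set.Ioi a) :=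
  fun _ _ hθ => slice_facts hθ

end Summit.FinalStateConjecture.FinalStateConjecture.Theorems.CrumPeelingRecessiveTower
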